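import Summits.NavierStokesRegularity.NavierStokesRegularity.Theorems.PowerGaugeEulerLiouville.Negative.NeedleWitnessProfile

/-!
# Crux E `PowerGaugeEulerLiouville` (route `EulerZoomLiouville`, stmt-NavierStokesRegularity-19832) — negative edge for THE ONE OPEN
# STATEMENT `Sig.stub_selfSimilarC2Needle` (`Cruxes/PowerGaugeEulerLiouville/Lines/birth.lean` v35, sha16 5ba6a2de3b8b3422, l.637):
# the class hypothesis `InClass ρ u p H c` is LOAD-BEARING (file 3 of 3, refuter seat ns-regularity-refuter1 g9, KILLSHEET K-63)

`stub_selfSimilarC2Needle_false_without_class`: the stub with the single hypothesis `InClass ρ u p H c` deleted (binder twins verbatim,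
`NeedleStubBinders.SelfSimilarC2NeedleWithoutClass`) is FALSE.  Witness at `ρ = ¼`: the exact self-similar collapse
`u♯(τ, x) = (−τ)^{γ−1} V♯((−τ)^{−γ}x) = c(τ) V♯(x)`, `γ = 4/9`, `c(τ) = (−τ)^{−1−γ}`, of the profile `V♯(y) = (y₁², y₂², y₀²)` of file 2,
with zero pressure profile: exactly self-similar; the profile is extremal, `C²`, not tame, not critically homogeneous (file 2); the endpoint
clause is void at `ρ ≠ ½`; `u♯` is NOT symmetric-weak (not time-periodic and not a traveling wave since `c(τ) < 1 = c(−1)` for `τ < −1` and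
`V♯ y = 0 ↔ y = 0`; no screw / translation symmetry of the modulus, which would have to fix the unique zero) and NOT classical-concentrating
(`V♯` is unbounded) — yet `u♯ ≠ 0` on `(−2,−1) × B(𝐞₀, ½)`, a set of positive measure.  So every proof of the stub MUST use the class (the
Euler identity and/or the three power gauges): the eight profile-side binders alone do not force triviality, and their conjunction is NOT
vacuous.  The witness is NOT in the class (its `A`-gauge `L^{2ρ−1}∫_{B_L}|V♯|² ∼ L^{13/2}` diverges), so nothing is claimed about the stub itself.

bears_on: N0 stmt-NavierStokesRegularity-19832 (crux E `PowerGaugeEulerLiouville`, OPEN) via the v35 residual stub; consumer = the line's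
planner / LEAD (binder hygiene, prover brief).  WHAT THIS IS NOT: not a claim about Navier–Stokes regularity or blow-up; not a refutation of
the stub, of crux E or of the route; no landed theorem is contradicted. [folklore]
-/

noncomputable section

set_option linter.dupNamespace false

namespace Summit.NavierStokesRegularity.NavierStokesRegularity.Theorems.PowerGaugeEulerLiouville.Negative

open MeasureTheory Set Function Filter Topology Metric
open scoped RealInnerProductSpace NNReal ENNReal Topology ContDiff
open Literature.Analysis Literature.Analysis.FluidPDE

local notation "E3" => EuclideanSpace ℝ (Fin 3)

/-- the standard basis vectors of `ℝ³`. -/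
local notation "𝐞₀" => (EuclideanSpace.single (0 : Fin 3) (1 : ℝ) : EuclideanSpace ℝ (Fin 3))
local notation "𝐞₁" => (EuclideanSpace.single (1 : Fin 3) (1 : ℝ) : EuclideanSpace ℝ (Fin 3))
local notation "𝐞₂" => (EuclideanSpace.single (2 : Fin 3) (1 : ℝ) : EuclideanSpace ℝ (Fin 3))

/-! ## §1 The collapsing witness `u♯ = selfSimilarCollapse γ 0 V♯`, `γ = 1/(2+¼)` -/

/-- the class exponent at `ρ = ¼`. -/
def γw : ℝ := 1 / (2 + 1 / 4)

/-- the witness velocity: the exact self-similar collapse of `V♯` with blow-up time `0`. -/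
def uw : ℝ → E3 → E3 := selfSimilarCollapse γw 0 Vw

/-- the witness pressure (identically zero profile). -/
def pw : ℝ → E3 → ℝ := selfSimilarCollapsePressure γw 0 (fun _ => 0)

/-- the time factor of the witness: `u♯(τ) = c(τ) • V♯`. -/
def cw (τ : ℝ) : ℝ := (0 - τ) ^ (γw - 1) * ((0 - τ) ^ (-γw) * (0 - τ) ^ (-γw))

/-- `u♯(τ, x) = c(τ) V♯(x)` (by the `2`-homogeneity of `V♯`). -/
theorem uw_apply (τ : ℝ) (x : E3) : uw τ x = cw τ • Vw x := by
  simp only [uw, selfSimilarCollapse_apply, Vw_smul, smul_smul, cw]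

/-- the time factor is positive on the past. -/
theorem cw_pos {τ : ℝ} (hτ : τ < 0) : 0 < cw τ := by
  have h : 0 < 0 - τ := by linarith
  unfold cw
  exact mul_pos (Real.rpow_pos_of_pos h _) (mul_pos (Real.rpow_pos_of_pos h _) (Real.rpow_pos_of_pos h _))

/-- the time factor is `< 1` strictly before `τ = −1`. -/
theorem cw_lt_one {τ : ℝ} (hτ : τ < -1) : cw τ < 1 := by
  have h : 1 < 0 - τ := by linarith
  have hγ : 0 < γw := by unfold γw; norm_num
  have hγ1 : γw - 1 < 0 := by unfold γw; norm_num
  have h1 : (0 - τ) ^ (γw - 1) < 1 := Real.rpow_lt_one_of_one_lt_of_neg h hγ1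
  have h2 : (0 - τ) ^ (-γw) < 1 := Real.rpow_lt_one_of_one_lt_of_neg h (by linarith)
  have h0 : 0 ≤ (0 - τ) ^ (-γw) := Real.rpow_nonneg (by linarith) _
  unfold cw
  exact mul_lt_one_of_nonneg_of_lt_one_left (Real.rpow_nonneg (by linarith) _) h1
    (mul_lt_one_of_nonneg_of_lt_one_left h0 h2 h2.le).le

/-- at `τ = −1` the witness velocity is the profile itself. -/
theorem uw_neg_one : uw (-1) = Vw := by
  funext x
  rw [uw_apply]
  simp [cw]

/-- `(u♯, p♯)` is exactly self-similar with profile `(V♯, 0)` at `ρ = ¼`. -/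
theorem isExactlySelfSimilar_w : IsExactlySelfSimilar (1 / 4) uw pw Vw (fun _ => 0) :=
  ⟨fun _ _ => rfl, fun _ _ => rfl⟩

/-- the witness is NOT symmetric-weak (for any weak-gradient binder `H`). -/
theorem not_isSymmetricWeak_w (H : ℝ → E3 → E3 →L[ℝ] E3) : ¬ IsSymmetricWeak uw H := by
  have hVe : Vw (𝐞₁) 0 = 1 := by simp
  rintro (⟨P, hP, h⟩ | ⟨U, G₀, b, hu, -⟩ | ⟨L, y₀, w, hw, hLw, h⟩)
  · -- time-periodic: `c(−1−P) V♯ = V♯` forces `c(−1−P) = 1`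
    have hh := congrArg (fun v : E3 => v 0) (congrFun (h (-1) (by norm_num)) (𝐞₁))
    simp only [uw_apply, PiLp.smul_apply, smul_eq_mul, hVe, mul_one] at hh
    have h1 : cw (-1 - P) < 1 := cw_lt_one (by linarith)
    have h2 : cw (-1) = 1 := by simp [cw]
    rw [h2] at hh
    linarith
  · -- traveling wave: `V♯(y + b) = c(−2) V♯(y)` forces `b = 0` and then `c(−2) = 1`
    have hU : ∀ y : E3, U (y + b) = Vw y := by
      intro y
      have hh := congrFun (congrFun hu (-1)) y
      rw [uw_neg_one] at hh
      rw [hh]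
      congr 1
      simp
    have hrel : ∀ y : E3, Vw (y + b) = cw (-2) • Vw y := by
      intro y
      have hh := congrFun (congrFun hu (-2)) y
      rw [uw_apply] at hh
      rw [hh, ← hU (y + b)]
      congr 1
      simp [two_smul]
      abel
    have hb : b = 0 := by
      have hh := hrel 0
      rw [zero_add, (Vw_eq_zero_iff 0).mpr rfl, smul_zero] at hh
      exact (Vw_eq_zero_iff b).mp hh
    have hh := congrArg (fun v : E3 => v 0) (hrel (𝐞₁))
    simp only [hb, add_zero, PiLp.smul_apply, smul_eq_mul, hVe, mul_one] at hh
    have h1 : cw (-2) < 1 := cw_lt_one (by norm_num)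
    linarith
  · -- screw / translation symmetry of the modulus: the zero of `V♯` is unique, so the symmetry fixes the origin, whence `w = 0`
    have hh := h (-1) (by norm_num) 0
    rw [uw_neg_one, (Vw_eq_zero_iff 0).mpr rfl, norm_zero, norm_eq_zero, Vw_eq_zero_iff, zero_sub, map_neg] at hh
    have hw' : w = L y₀ - y₀ := by
      rw [eq_sub_iff_add_eq]
      have : -L y₀ + y₀ + w + L y₀ = 0 + L y₀ := by rw [hh]
      simpa [add_comm, add_left_comm] using this
    have hinner : inner ℝ w w = (0 : ℝ) := by
      calc inner ℝ w w = inner ℝ (L y₀ - y₀) w := by rw [← hw']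
        _ = inner ℝ (L y₀) w - inner ℝ y₀ w := inner_sub_left _ _ _
        _ = inner ℝ (L y₀) (L w) - inner ℝ y₀ w := by rw [hLw]
        _ = 0 := by rw [LinearIsometryEquiv.inner_map_map]; ring
    exact hw (inner_self_eq_zero.mp hinner)

/-- the witness is NOT classical-concentrating at `ρ = ¼` (clause (a) fails: `V♯` is unbounded). -/
theorem not_isClassicalConcentrating_w : ¬ IsClassicalConcentrating (1 / 4) uw pw := by
  rintro ⟨-, ⟨M, hM⟩, -⟩
  set t : ℝ := |M| + 1 with ht
  have ht1 : 1 ≤ t := by rw [ht]; linarith [abs_nonneg M]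
  have hh := hM (-1) (by norm_num) (t • 𝐞₁)
  rw [uw_neg_one] at hh
  simp only [neg_neg, Real.one_rpow, mul_one] at hh
  have h1 : ‖Vw (t • 𝐞₁) 0‖ ≤ ‖Vw (t • 𝐞₁)‖ := PiLp.norm_apply_le _ 0
  rw [Vw_apply_zero] at h1
  simp at h1
  have h2 : t ≤ t * t := by nlinarith
  linarith [le_abs_self M]

/-- the witness is NOT a.e. zero on the open past: `u♯ ≠ 0` on `(−2,−1) × B(𝐞₀, ½)`, a set of positive measure. -/
theorem uw_not_ae_zero : ¬ (Function.uncurry uw =ᵐ[volume.restrict (Set.Iio (0 : ℝ) ×ˢ (Set.univ : Set E3))] 0) := by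
  intro h
  have hS : MeasurableSet (Set.Iio (0 : ℝ) ×ˢ (Set.univ : Set E3)) := measurableSet_Iio.prod MeasurableSet.univ
  have h' := (ae_restrict_iff' hS).mp h
  rw [ae_iff] at h'
  set K : Set (ℝ × E3) := Set.Ioo (-2 : ℝ) (-1) ×ˢ ball ((1 : ℝ) • 𝐞₀) (1 / 2) with hK
  have hsub : K ⊆ {z : ℝ × E3 | ¬ (z ∈ Set.Iio (0 : ℝ) ×ˢ (Set.univ : Set E3) →
      Function.uncurry uw z = (0 : ℝ × E3 → E3) z)} := by
    rintro ⟨τ, x⟩ ⟨hτ, hx⟩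
    simp only [Set.mem_setOf_eq, Set.mem_prod, Set.mem_Iio, Set.mem_univ, and_true, Function.uncurry_apply_pair,
      Pi.zero_apply, Classical.not_imp]
    refine ⟨by linarith [hτ.2], ?_⟩
    rw [uw_apply, smul_eq_zero, not_or]
    refine ⟨(cw_pos (by linarith [hτ.2])).ne', ?_⟩
    intro hx0'
    have hx0 := (Vw_eq_zero_iff x).mp hx0'
    rw [hx0, mem_ball, dist_eq_norm, zero_sub, norm_neg, norm_smul, PiLp.norm_single, norm_one, mul_one] at hx
    norm_num at hx
  have hK0 : volume K = 0 := measure_mono_null hsub h'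
  have hKpos : 0 < volume K := by
    rw [hK, Measure.volume_eq_prod, Measure.prod_prod]
    exact ENNReal.mul_pos (by rw [Real.volume_Ioo]; norm_num) (measure_ball_pos volume _ (by norm_num)).ne'
  exact hKpos.ne' hK0

/-! ## §2 The negative edge -/

/-- **K-63 (refuter1 g9): the class hypothesis of THE ONE STATEMENT is load-bearing.**  `Birth.Sig.stub_selfSimilarC2Needle`
(v35) with `InClass ρ u p H c` deleted is FALSE: at `ρ = ¼` the exact self-similar collapse `u♯` of the quadratic divergence-free
profile `V♯(y) = (y₁², y₂², y₀²)` satisfies every remaining hypothesis (extremal, `C²`, not tame, not critically homogeneous, not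
symmetric-weak, not classical-concentrating; the endpoint clause is void at `ρ ≠ ½`) and is not a.e. zero. [folklore] -/
theorem stub_selfSimilarC2Needle_false_without_class : ¬ SelfSimilarC2NeedleWithoutClass := by
  intro h
  exact uw_not_ae_zero
    (h (1 / 4) (by norm_num) (by norm_num) uw pw 0 Vw (fun _ => 0) isExactlySelfSimilar_w isExtremalProfile_Vw
      contDiff_Vw not_isTameC2Profile_Vw not_isHomogeneousProfile_Vw (fun hh => absurd hh.1 (by norm_num))
      (not_isSymmetricWeak_w 0) not_isClassicalConcentrating_w)


end Summit.NavierStokesRegularity.NavierStokesRegularity.Theorems.PowerGaugeEulerLiouville.Negative
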